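import Summits.NavierStokesRegularity.NavierStokesRegularity.Theorems.LerayQuarterDissipationFiniteDissipationLiouvilleEnergyTraceDatum
import Literature.Analysis.FluidPDE.NSLocalLerayFarFieldTrace
import Literature.Analysis.FluidPDE.NSVorticityBKMProofs
import HarnessLib

/-!
# Crux `FiniteDissipationLiouville` (stmt-NavierStokesRegularity-22144): NO VORTICITY CONCENTRATION
# AT A FINITE-DISSIPATION TYPE-I SINGULAR POINT — the gradient and the vorticity converge in
# `L¹(ℝ³)` to those of the final datum, which is weakly divergence-free across the apex

Theorems file of route `LerayQuarterDissipation` (lead prover ns-lqd-lead g9; `--supports` the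
crux, line `birth`; completes the final-datum portrait of `…FinalDatumProfile` (lead g7) and
`…EnergyTraceDatum`). Navier–Stokes regularity is NOT proved by anything here; no summit is.

Setting: a Type-I ancient mild field `W` (KNSS gauge) with the gradient envelope
`‖∇W(t,x)‖ ≤ L₁/(‖x‖ + √(−t))²` (the `n = 1` clause of the scale-invariant package of the
critical element, `…EnvelopePackage`) and a final-datum gradient `Du₀` off the apex with
`‖Du₀(x)‖ ≤ L₁/‖x‖²` and `‖∇W(t,x) − Du₀(x)‖ ≤ L₁(−t)/‖x‖⁴` (`…FinalDatumProfile`, lead g7).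

* `lintegral_enorm_sub_le_of_gradient_envelopes` (real analysis on `ℝ³`) and
  `lintegral_fderiv_sub_finalDatum_le` — **THE GRADIENT CONVERGES IN `L¹(ℝ³)`**:
  `∫_{ℝ³} ‖∇W(t) − Du₀‖ ≤ 9|B₁| L₁ √(−t)` (inside `B(0,√(−t))` both gradients are `≤ 2L₁‖x‖⁻²`,
  integrable: `∫_{B_a}‖x‖⁻² = 3|B₁|a`; outside, the rate and `∫_{B_aᶜ}‖x‖⁻⁴ = 3|B₁|/a`). Neither
  `∇W(t)` nor `Du₀` is integrable (both `≍ ‖x‖⁻²` at infinity); their difference is, and it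
  vanishes in `L¹` at the parabolic rate.
* `lintegral_curl_sub_finalDatum_le` — **THE VORTICITY CONVERGES IN `L¹(ℝ³)`** to
  `ω₀ := curlCLM ∘ Du₀` (the pointwise vorticity of `u₀` off the apex):
  `∫ ‖curl W(t) − ω₀‖ ≤ 36|B₁| L₁ √(−t)` (`‖curlCLM‖ ≤ 4`).
* `lintegral_ball_curlDatum_le` — `∫_{B(0,ρ)} ‖ω₀‖ ≤ 12|B₁| L₁ ρ`: the final-time vorticity is an
  `L¹_loc` FUNCTION with the Morrey scaling of `‖x‖⁻²`; in particular it carries NO ATOM and no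
  singular part at the apex.
* `tendsto_pairing_curl_finalDatum` — **the distributional vorticity of the final datum IS the
  function `ω₀`, across the apex**: `∫⟪W(t), curl ψ⟫ → ∫⟪ω₀, ψ⟫` for EVERY test field `ψ`
  (integration by parts at `t < 0`, `integral_inner_curl_eq_of_contDiffOn`, then the `L¹` bound).
  With lead g6's clauses (the trace is ROTATIONAL in every punctured ball at the apex and its
  vorticity saturates `‖x‖⁻²` in the weighted sense) the final-time vorticity of a Type-I
  finite-dissipation singularity is a genuinely `‖x‖⁻²`-sized INTEGRABLE function at the apex:
  no vortex atom, no vortex filament through the singular point, no concentration.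
* companion file `…FinalDatumVorticityMinimal`: the final datum is weakly divergence-free across
  the apex, and the package for the CRITICAL ELEMENT (portrait clause of skeleton v18).

HONEST FRAMING: structural facts about a putative counterexample (constants from the
scale-invariant package); nothing here removes a scenario; no summit is proved.

References: Koch–Nadirashvili–Seregin–Šverák, Acta Math. 203 (2009), §4; Caffarelli–Kohn–Nirenberg
1982 (no concentration heuristics); Bradshaw–Tsai 2017 (DSS data class).
-/

noncomputable section

-- the summit and its single sub-problem share the name (CONVENTIONS §1), as in every Theorems file
set_option linter.dupNamespace false

namespace Summit.NavierStokesRegularity.NavierStokesRegularity.Theorems.FiniteDissipationLiouville.FinalDatumVorticity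

open MeasureTheory Set Filter Topology Metric Function TopologicalSpace
open Literature.Analysis Literature.Analysis.FluidPDE
open Summit.NavierStokesRegularity.NavierStokesRegularity.Theorems.FiniteDissipationLiouville
open Summit.NavierStokesRegularity.NavierStokesRegularity.Theorems
open scoped ENNReal NNReal RealInnerProductSpace

variable {C : ℝ} {W : ℝ → EuclideanSpace ℝ (Fin 3) → EuclideanSpace ℝ (Fin 3)}

/-! ### Real analysis: `L¹` smallness of the gradient remainder -/

/-- **`L¹` bound for the difference of two gradient-type fields under the two envelopes.** On
`ℝ³`, if `‖G(x)‖ ≤ L/(‖x‖+a)²`, `‖D(x)‖ ≤ L/‖x‖²` and `‖G(x) − D(x)‖ ≤ L a²/‖x‖⁴` off the origin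
(`a > 0`), then `∫ ‖G − D‖ ≤ 3 · 3|B₁| · L · a`. -/
theorem lintegral_enorm_sub_le_of_gradient_envelopes {F : Type*} [NormedAddCommGroup F]
    {L a : ℝ} (ha : 0 < a) (hL : 0 ≤ L) {G D : EuclideanSpace ℝ (Fin 3) → F}
    (hG : ∀ x, ‖G x‖ ≤ L / (‖x‖ + a) ^ 2)
    (hD : ∀ x : EuclideanSpace ℝ (Fin 3), x ≠ 0 → ‖D x‖ ≤ L / ‖x‖ ^ 2)
    (hrate : ∀ x : EuclideanSpace ℝ (Fin 3), x ≠ 0 → ‖G x - D x‖ ≤ L * a ^ 2 / ‖x‖ ^ 4) :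
    ∫⁻ x, ‖G x - D x‖ₑ ≤
      ENNReal.ofReal (3 * (3 * (volume : Measure (EuclideanSpace ℝ (Fin 3))).real (ball 0 1)) * L * a) := by
  have hne : ∀ᵐ x ∂(volume : Measure (EuclideanSpace ℝ (Fin 3))), x ≠ 0 := by
    rw [ae_iff]
    have e : {x : EuclideanSpace ℝ (Fin 3) | ¬ x ≠ 0} = {0} := by ext x; simp
    rw [e]; exact measure_singleton 0
  set V : ℝ := 3 * (volume : Measure (EuclideanSpace ℝ (Fin 3))).real (ball 0 1) with hV
  have hV0 : 0 ≤ V := by rw [hV]; positivity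
  -- pointwise bound near the origin: `‖G − D‖ ≤ 2L ‖x‖⁻²`
  have hin : ∀ x : EuclideanSpace ℝ (Fin 3), x ≠ 0 →
      ‖G x - D x‖ₑ ≤ ENNReal.ofReal (2 * L) * ENNReal.ofReal (‖x‖ ^ (-(2 : ℝ))) := by
    intro x hx
    have hxpos : 0 < ‖x‖ := norm_pos_iff.2 hx
    have e : ‖x‖ ^ (-(2 : ℝ)) = (‖x‖ ^ 2)⁻¹ := by rw [Real.rpow_neg hxpos.le, Real.rpow_two]
    have h1 : L / (‖x‖ + a) ^ 2 ≤ L / ‖x‖ ^ 2 :=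
      div_le_div_of_nonneg_left hL (by positivity)
        (pow_le_pow_left₀ hxpos.le (by linarith) 2)
    have h2 : ‖G x - D x‖ ≤ 2 * L * ‖x‖ ^ (-(2 : ℝ)) := by
      rw [e]
      calc ‖G x - D x‖ ≤ ‖G x‖ + ‖D x‖ := norm_sub_le _ _
        _ ≤ L / ‖x‖ ^ 2 + L / ‖x‖ ^ 2 := add_le_add ((hG x).trans h1) (hD x hx)
        _ = 2 * L * (‖x‖ ^ 2)⁻¹ := by ring
    calc ‖G x - D x‖ₑ = ENNReal.ofReal ‖G x - D x‖ := (ofReal_norm _).symm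
      _ ≤ ENNReal.ofReal (2 * L * ‖x‖ ^ (-(2 : ℝ))) := ENNReal.ofReal_le_ofReal h2
      _ = _ := ENNReal.ofReal_mul (by positivity)
  -- pointwise bound away from the origin: `‖G − D‖ ≤ L a² ‖x‖⁻⁴`
  have hout : ∀ x : EuclideanSpace ℝ (Fin 3), a ≤ ‖x‖ →
      ‖G x - D x‖ₑ ≤ ENNReal.ofReal (L * a ^ 2) * ENNReal.ofReal (‖x‖ ^ (-(4 : ℝ))) := by
    intro x hx
    have hxpos : 0 < ‖x‖ := ha.trans_le hx
    have hx0 : x ≠ 0 := norm_pos_iff.1 hxpos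
    have e : ‖x‖ ^ (-(4 : ℝ)) = (‖x‖ ^ 4)⁻¹ := by
      rw [Real.rpow_neg hxpos.le, show (4 : ℝ) = ((4 : ℕ) : ℝ) by norm_num, Real.rpow_natCast]
    have h2 : ‖G x - D x‖ ≤ L * a ^ 2 * ‖x‖ ^ (-(4 : ℝ)) := by
      rw [e, ← div_eq_mul_inv]; exact hrate x hx0
    calc ‖G x - D x‖ₑ = ENNReal.ofReal ‖G x - D x‖ := (ofReal_norm _).symm
      _ ≤ ENNReal.ofReal (L * a ^ 2 * ‖x‖ ^ (-(4 : ℝ))) := ENNReal.ofReal_le_ofReal h2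
      _ = _ := ENNReal.ofReal_mul (by positivity)
  -- the two integrals
  have I1 : ∫⁻ x in ball (0 : EuclideanSpace ℝ (Fin 3)) a, ‖G x - D x‖ₑ ≤
      ENNReal.ofReal (2 * L * V * a) := by
    calc ∫⁻ x in ball (0 : EuclideanSpace ℝ (Fin 3)) a, ‖G x - D x‖ₑ
        ≤ ∫⁻ x in ball (0 : EuclideanSpace ℝ (Fin 3)) a,
            ENNReal.ofReal (2 * L) * ENNReal.ofReal (‖x‖ ^ (-(2 : ℝ))) := by
          refine lintegral_mono_ae ?_
          filter_upwards [ae_restrict_of_ae hne] with x hx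
          exact hin x hx
      _ = ENNReal.ofReal (2 * L) * ENNReal.ofReal (V * (a ^ ((3 : ℝ) - 2) / (3 - 2))) := by
          rw [lintegral_const_mul' _ _ ENNReal.ofReal_ne_top,
            NewtonPotentialHolder.lintegral_ball_norm_rpow_neg (by norm_num) ha]
      _ = ENNReal.ofReal (2 * L * V * a) := by
          rw [← ENNReal.ofReal_mul (by positivity)]
          congr 1
          have e : a ^ ((3 : ℝ) - 2) = a := by norm_num
          rw [e]; ring
  have I2 : ∫⁻ x in (ball (0 : EuclideanSpace ℝ (Fin 3)) a)ᶜ, ‖G x - D x‖ₑ ≤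
      ENNReal.ofReal (L * V * a) := by
    calc ∫⁻ x in (ball (0 : EuclideanSpace ℝ (Fin 3)) a)ᶜ, ‖G x - D x‖ₑ
        ≤ ∫⁻ x in (ball (0 : EuclideanSpace ℝ (Fin 3)) a)ᶜ,
            ENNReal.ofReal (L * a ^ 2) * ENNReal.ofReal (‖x‖ ^ (-(4 : ℝ))) := by
          refine lintegral_mono_ae (ae_restrict_of_forall_mem measurableSet_ball.compl fun x hx => ?_)
          refine hout x ?_
          rw [mem_compl_iff, mem_ball_zero_iff, not_lt] at hx
          exact hx
      _ = ENNReal.ofReal (L * a ^ 2) * ENNReal.ofReal (V * (a ^ ((3 : ℝ) - 4) / (4 - 3))) := by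
          rw [lintegral_const_mul' _ _ ENNReal.ofReal_ne_top,
            NewtonPotentialHolder.lintegral_compl_ball_norm_rpow_neg (by norm_num) ha]
      _ = ENNReal.ofReal (L * V * a) := by
          rw [← ENNReal.ofReal_mul (by positivity)]
          congr 1
          have e : a ^ ((3 : ℝ) - 4) = a⁻¹ := by
            rw [show (3 : ℝ) - 4 = -1 by norm_num, Real.rpow_neg_one]
          rw [e]; field_simp; ring
  calc ∫⁻ x, ‖G x - D x‖ₑ
      = (∫⁻ x in ball (0 : EuclideanSpace ℝ (Fin 3)) a, ‖G x - D x‖ₑ) +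
          ∫⁻ x in (ball (0 : EuclideanSpace ℝ (Fin 3)) a)ᶜ, ‖G x - D x‖ₑ :=
        (lintegral_add_compl _ measurableSet_ball).symm
    _ ≤ ENNReal.ofReal (2 * L * V * a) + ENNReal.ofReal (L * V * a) := add_le_add I1 I2
    _ = ENNReal.ofReal (3 * V * L * a) := by
        rw [← ENNReal.ofReal_add (by positivity) (by positivity)]; congr 1; ring

/-! ### The gradient and the vorticity converge in `L¹(ℝ³)` -/

/-- **The gradient of a Type-I profile converges to that of its final datum in `L¹(ℝ³)`**:
`∫ ‖∇W(t) − Du₀‖ ≤ 9|B₁| L₁ √(−t)` for every `t < 0`. -/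
theorem lintegral_fderiv_sub_finalDatum_le {L₁ : ℝ}
    {Du₀ : EuclideanSpace ℝ (Fin 3) → ((EuclideanSpace ℝ (Fin 3)) →L[ℝ] (EuclideanSpace ℝ (Fin 3)))}
    (hgradW : ∀ t : ℝ, t < 0 → ∀ x, ‖fderiv ℝ (W t) x‖ ≤ L₁ / (‖x‖ + Real.sqrt (-t)) ^ 2)
    (hgenv : ∀ x : EuclideanSpace ℝ (Fin 3), x ≠ 0 → ‖Du₀ x‖ ≤ L₁ / ‖x‖ ^ 2)
    (hgrate : ∀ x : EuclideanSpace ℝ (Fin 3), x ≠ 0 → ∀ t : ℝ, t < 0 →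
      ‖fderiv ℝ (W t) x - Du₀ x‖ ≤ L₁ * (-t) / ‖x‖ ^ 4) {t : ℝ} (ht : t < 0) :
    ∫⁻ x, ‖fderiv ℝ (W t) x - Du₀ x‖ₑ ≤
      ENNReal.ofReal (3 * (3 * (volume : Measure (EuclideanSpace ℝ (Fin 3))).real (ball 0 1)) *
        L₁ * Real.sqrt (-t)) := by
  set a : ℝ := Real.sqrt (-t) with ha_def
  have ha : 0 < a := Real.sqrt_pos.2 (neg_pos.2 ht)
  have ha2 : a ^ 2 = -t := Real.sq_sqrt (neg_nonneg.2 ht.le)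
  have hL₁ : 0 ≤ L₁ := by
    have h := (norm_nonneg _).trans (hgradW t ht 0)
    rw [norm_zero, zero_add] at h
    exact (div_nonneg_iff.1 h).elim (fun h' => h'.1) fun h' => absurd h'.2 (not_le.2 (pow_pos ha 2))
  refine lintegral_enorm_sub_le_of_gradient_envelopes ha hL₁ (hgradW t ht) hgenv fun x hx => ?_
  rw [ha2]; exact hgrate x hx t ht

/-- **The vorticity of a Type-I profile converges in `L¹(ℝ³)` to the vorticity `ω₀ = curlCLM ∘ Du₀`
of its final datum**: `∫ ‖curl W(t) − ω₀‖ ≤ 36|B₁| L₁ √(−t)`. -/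
theorem lintegral_curl_sub_finalDatum_le {L₁ : ℝ}
    {Du₀ : EuclideanSpace ℝ (Fin 3) → ((EuclideanSpace ℝ (Fin 3)) →L[ℝ] (EuclideanSpace ℝ (Fin 3)))}
    (hgradW : ∀ t : ℝ, t < 0 → ∀ x, ‖fderiv ℝ (W t) x‖ ≤ L₁ / (‖x‖ + Real.sqrt (-t)) ^ 2)
    (hgenv : ∀ x : EuclideanSpace ℝ (Fin 3), x ≠ 0 → ‖Du₀ x‖ ≤ L₁ / ‖x‖ ^ 2)
    (hgrate : ∀ x : EuclideanSpace ℝ (Fin 3), x ≠ 0 → ∀ t : ℝ, t < 0 →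
      ‖fderiv ℝ (W t) x - Du₀ x‖ ≤ L₁ * (-t) / ‖x‖ ^ 4) {t : ℝ} (ht : t < 0) :
    ∫⁻ x, ‖curl (W t) x - curlCLM (Du₀ x)‖ₑ ≤
      ENNReal.ofReal (4 * (3 * (3 * (volume : Measure (EuclideanSpace ℝ (Fin 3))).real (ball 0 1)) *
        L₁ * Real.sqrt (-t))) := by
  have hpt : ∀ x, ‖curl (W t) x - curlCLM (Du₀ x)‖ₑ ≤
      ENNReal.ofReal 4 * ‖fderiv ℝ (W t) x - Du₀ x‖ₑ := by
    intro x
    rw [curl_eq_curlCLM, ← map_sub, ← ofReal_norm, ← ofReal_norm, ← ENNReal.ofReal_mul (by norm_num)]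
    refine ENNReal.ofReal_le_ofReal ?_
    exact (ContinuousLinearMap.le_opNorm _ _).trans
      (mul_le_mul_of_nonneg_right norm_curlCLM_le_four (norm_nonneg _))
  calc ∫⁻ x, ‖curl (W t) x - curlCLM (Du₀ x)‖ₑ
      ≤ ∫⁻ x, ENNReal.ofReal 4 * ‖fderiv ℝ (W t) x - Du₀ x‖ₑ := lintegral_mono hpt
    _ = ENNReal.ofReal 4 * ∫⁻ x, ‖fderiv ℝ (W t) x - Du₀ x‖ₑ :=
        lintegral_const_mul' _ _ ENNReal.ofReal_ne_top
    _ ≤ ENNReal.ofReal 4 * ENNReal.ofReal (3 * (3 * (volume : Measure (EuclideanSpace ℝ (Fin 3))).real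
          (ball 0 1)) * L₁ * Real.sqrt (-t)) := by
        gcongr; exact lintegral_fderiv_sub_finalDatum_le hgradW hgenv hgrate ht
    _ = _ := by rw [← ENNReal.ofReal_mul (by norm_num)]

/-- **The final-time vorticity is an `L¹_loc` function with the Morrey scaling of `‖x‖⁻²`**:
`∫_{B(0,ρ)} ‖ω₀‖ ≤ 12|B₁| L₁ ρ` under `‖Du₀(x)‖ ≤ L₁/‖x‖²`. No atom at the apex. -/
theorem lintegral_ball_curlDatum_le {L₁ : ℝ}
    {Du₀ : EuclideanSpace ℝ (Fin 3) → ((EuclideanSpace ℝ (Fin 3)) →L[ℝ] (EuclideanSpace ℝ (Fin 3)))}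
    (hgenv : ∀ x : EuclideanSpace ℝ (Fin 3), x ≠ 0 → ‖Du₀ x‖ ≤ L₁ / ‖x‖ ^ 2) {ρ : ℝ} (hρ : 0 < ρ) :
    ∫⁻ x in ball (0 : EuclideanSpace ℝ (Fin 3)) ρ, ‖curlCLM (Du₀ x)‖ₑ ≤
      ENNReal.ofReal (4 * (3 * (volume : Measure (EuclideanSpace ℝ (Fin 3))).real (ball 0 1)) * L₁ * ρ) := by
  have hne : ∀ᵐ x ∂(volume : Measure (EuclideanSpace ℝ (Fin 3))), x ≠ 0 := by
    rw [ae_iff]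
    have e : {x : EuclideanSpace ℝ (Fin 3) | ¬ x ≠ 0} = {0} := by ext x; simp
    rw [e]; exact measure_singleton 0
  -- the sign of `L₁`, from the hypothesis at a unit vector
  have hL₁ : 0 ≤ L₁ := by
    set e₀ : EuclideanSpace ℝ (Fin 3) := EuclideanSpace.single 0 1 with he₀
    have he₀n : ‖e₀‖ = 1 := by simp [he₀]
    have he₀0 : e₀ ≠ 0 := by
      intro h; rw [h, norm_zero] at he₀n; exact zero_ne_one he₀n
    have h := hgenv e₀ he₀0
    rw [he₀n, one_pow, div_one] at h
    exact (norm_nonneg _).trans h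
  have hpt : ∀ x : EuclideanSpace ℝ (Fin 3), x ≠ 0 →
      ‖curlCLM (Du₀ x)‖ₑ ≤ ENNReal.ofReal (4 * L₁) * ENNReal.ofReal (‖x‖ ^ (-(2 : ℝ))) := by
    intro x hx
    have hxpos : 0 < ‖x‖ := norm_pos_iff.2 hx
    have e : ‖x‖ ^ (-(2 : ℝ)) = (‖x‖ ^ 2)⁻¹ := by rw [Real.rpow_neg hxpos.le, Real.rpow_two]
    have h2 : ‖curlCLM (Du₀ x)‖ ≤ 4 * L₁ * ‖x‖ ^ (-(2 : ℝ)) := by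
      rw [e]
      calc ‖curlCLM (Du₀ x)‖ ≤ ‖curlCLM‖ * ‖Du₀ x‖ := ContinuousLinearMap.le_opNorm _ _
        _ ≤ 4 * (L₁ / ‖x‖ ^ 2) :=
            mul_le_mul norm_curlCLM_le_four (hgenv x hx) (norm_nonneg _) (by norm_num)
        _ = 4 * L₁ * (‖x‖ ^ 2)⁻¹ := by ring
    calc ‖curlCLM (Du₀ x)‖ₑ = ENNReal.ofReal ‖curlCLM (Du₀ x)‖ := (ofReal_norm _).symm
      _ ≤ ENNReal.ofReal (4 * L₁ * ‖x‖ ^ (-(2 : ℝ))) := ENNReal.ofReal_le_ofReal h2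
      _ = _ := ENNReal.ofReal_mul (by positivity)
  calc ∫⁻ x in ball (0 : EuclideanSpace ℝ (Fin 3)) ρ, ‖curlCLM (Du₀ x)‖ₑ
      ≤ ∫⁻ x in ball (0 : EuclideanSpace ℝ (Fin 3)) ρ,
          ENNReal.ofReal (4 * L₁) * ENNReal.ofReal (‖x‖ ^ (-(2 : ℝ))) := by
        refine lintegral_mono_ae ?_
        filter_upwards [ae_restrict_of_ae hne] with x hx
        exact hpt x hx
    _ = ENNReal.ofReal (4 * L₁) * ENNReal.ofReal (3 * (volume : Measure (EuclideanSpace ℝ (Fin 3))).real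
          (ball 0 1) * (ρ ^ ((3 : ℝ) - 2) / (3 - 2))) := by
        rw [lintegral_const_mul' _ _ ENNReal.ofReal_ne_top,
          NewtonPotentialHolder.lintegral_ball_norm_rpow_neg (by norm_num) hρ]
    _ = _ := by
        rw [← ENNReal.ofReal_mul (by positivity)]
        congr 1
        have e : ρ ^ ((3 : ℝ) - 2) = ρ := by norm_num
        rw [e]; ring

/-! ### The distributional vorticity of the final datum is the function `ω₀`, across the apex -/

/-- **The final-datum gradient is measurable** (pointwise limit, off the null origin, of the
continuous gradients `∇W(−1/(n+1))`). -/
theorem aestronglyMeasurable_finalDatumGradient (hW : IsTypeIAncientMild C W) {L₁ : ℝ}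
    {Du₀ : EuclideanSpace ℝ (Fin 3) → ((EuclideanSpace ℝ (Fin 3)) →L[ℝ] (EuclideanSpace ℝ (Fin 3)))}
    (hgrate : ∀ x : EuclideanSpace ℝ (Fin 3), x ≠ 0 → ∀ t : ℝ, t < 0 →
      ‖fderiv ℝ (W t) x - Du₀ x‖ ≤ L₁ * (-t) / ‖x‖ ^ 4) :
    AEStronglyMeasurable Du₀ (volume : Measure (EuclideanSpace ℝ (Fin 3))) := by
  have hne : ∀ᵐ x ∂(volume : Measure (EuclideanSpace ℝ (Fin 3))), x ≠ 0 := by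
    rw [ae_iff]
    have e : {x : EuclideanSpace ℝ (Fin 3) | ¬ x ≠ 0} = {0} := by ext x; simp
    rw [e]; exact measure_singleton 0
  set τ : ℕ → ℝ := fun n => -(1 / ((n : ℝ) + 1)) with hτ
  have hτneg : ∀ n, τ n < 0 := fun n => by
    have : (0 : ℝ) < 1 / ((n : ℝ) + 1) := by positivity
    show -(1 / ((n : ℝ) + 1)) < 0
    linarith
  have hτt : Tendsto (fun n => -τ n) atTop (𝓝 0) := by
    refine (tendsto_one_div_add_atTop_nhds_zero_nat (𝕜 := ℝ)).congr fun n => ?_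
    show 1 / ((n : ℝ) + 1) = -(-(1 / ((n : ℝ) + 1)))
    ring
  refine aestronglyMeasurable_of_tendsto_ae atTop (f := fun n x => fderiv ℝ (W (τ n)) x)
    (fun n => ((hW.contDiff_slice (hτneg n)).continuous_fderiv (by simp)).aestronglyMeasurable) ?_
  filter_upwards [hne] with x hx
  rw [tendsto_iff_norm_sub_tendsto_zero]
  have hb : Tendsto (fun n => L₁ * (-τ n) / ‖x‖ ^ 4) atTop (𝓝 0) := by
    have := (hτt.const_mul L₁).div_const (‖x‖ ^ 4)
    rw [mul_zero, zero_div] at this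
    exact this
  exact squeeze_zero (fun n => norm_nonneg _) (fun n => hgrate x hx (τ n) (hτneg n)) hb

/-- **THE DISTRIBUTIONAL VORTICITY OF THE FINAL DATUM IS THE FUNCTION `ω₀ = curlCLM ∘ Du₀`, FOR
EVERY TEST FIELD — across the apex.** For a Type-I ancient mild field with the gradient envelope
and the final-datum gradient rate: `∫⟪W(t), curl ψ⟫ → ∫⟪ω₀, ψ⟫` as `t → 0⁻` for every test
field `ψ` (integration by parts at `t < 0`, then the `L¹(ℝ³)` convergence of the vorticity). [cite: KochNadirashviliSereginSverak2009, §4 (arXiv:0709.3599 p. 8)] -/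
theorem tendsto_pairing_curl_finalDatum (hW : IsTypeIAncientMild C W) {L₁ : ℝ}
    {Du₀ : EuclideanSpace ℝ (Fin 3) → ((EuclideanSpace ℝ (Fin 3)) →L[ℝ] (EuclideanSpace ℝ (Fin 3)))}
    (hgradW : ∀ t : ℝ, t < 0 → ∀ x, ‖fderiv ℝ (W t) x‖ ≤ L₁ / (‖x‖ + Real.sqrt (-t)) ^ 2)
    (hgenv : ∀ x : EuclideanSpace ℝ (Fin 3), x ≠ 0 → ‖Du₀ x‖ ≤ L₁ / ‖x‖ ^ 2)
    (hgrate : ∀ x : EuclideanSpace ℝ (Fin 3), x ≠ 0 → ∀ t : ℝ, t < 0 →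
      ‖fderiv ℝ (W t) x - Du₀ x‖ ≤ L₁ * (-t) / ‖x‖ ^ 4)
    {ψ : EuclideanSpace ℝ (Fin 3) → EuclideanSpace ℝ (Fin 3)}
    (hψ : FunctionSpaces.IsTestFunctionOn (⊤ : Opens (EuclideanSpace ℝ (Fin 3))) ψ) :
    Tendsto (fun t => ∫ x, ⟪W t x, curl ψ x⟫) (𝓝[<] 0)
      (𝓝 (∫ x, ⟪curlCLM (Du₀ x), ψ x⟫)) := by
  have hcψ : Continuous ψ := hψ.contDiff.continuous
  have hψcs : HasCompactSupport ψ := hψ.hasCompactSupport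
  obtain ⟨Kψ, hKψ⟩ := hcψ.bounded_above_of_compact_support hψcs
  have hK0 : 0 ≤ Kψ := (norm_nonneg _).trans (hKψ 0)
  set V : ℝ := 3 * (volume : Measure (EuclideanSpace ℝ (Fin 3))).real (ball 0 1) with hV
  have hDm := aestronglyMeasurable_finalDatumGradient hW hgrate
  have hωm : AEStronglyMeasurable (fun x => curlCLM (Du₀ x))
      (volume : Measure (EuclideanSpace ℝ (Fin 3))) := curlCLM.continuous.comp_aestronglyMeasurable hDm
  -- ### Step 1: integration by parts at `t < 0`
  have hIBP : ∀ t : ℝ, t < 0 → ∫ x, ⟪W t x, curl ψ x⟫ = ∫ x, ⟪curl (W t) x, ψ x⟫ := by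
    intro t ht
    exact (integral_inner_curl_eq_of_contDiffOn isOpen_univ
      ((hW.contDiff_slice ht).of_le (by norm_cast)).contDiffOn
      (hψ.contDiff.of_le (by norm_cast)) hψcs (subset_univ _)).symm
  -- ### Step 2: the difference `curl W(t) − ω₀` is integrable with small `L¹` norm
  have hdiff_int : ∀ t : ℝ, t < 0 →
      Integrable (fun x => curl (W t) x - curlCLM (Du₀ x)) (volume : Measure (EuclideanSpace ℝ (Fin 3))) := by
    intro t ht
    have hmeas : AEStronglyMeasurable (fun x => curl (W t) x - curlCLM (Du₀ x))
        (volume : Measure (EuclideanSpace ℝ (Fin 3))) := by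
      refine AEStronglyMeasurable.sub ?_ hωm
      have hc : Continuous (curl (W t)) := by
        have e : curl (W t) = fun x => curlCLM (fderiv ℝ (W t) x) :=
          funext fun x => curl_eq_curlCLM _ _
        rw [e]
        exact curlCLM.continuous.comp ((hW.contDiff_slice ht).continuous_fderiv (by simp))
      exact hc.aestronglyMeasurable
    refine ⟨hmeas, ?_⟩
    exact lt_of_le_of_lt (lintegral_curl_sub_finalDatum_le hgradW hgenv hgrate ht) ENNReal.ofReal_lt_top
  -- ### Step 3: the pairings and the estimate
  have hest : ∀ t : ℝ, t < 0 →
      ‖(∫ x, ⟪W t x, curl ψ x⟫) - ∫ x, ⟪curlCLM (Du₀ x), ψ x⟫‖ ≤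
        Kψ * (4 * (3 * V * L₁ * Real.sqrt (-t))) := by
    intro t ht
    rw [hIBP t ht]
    have hint1 : Integrable (fun x => ⟪curl (W t) x, ψ x⟫) (volume : Measure (EuclideanSpace ℝ (Fin 3))) := by
      have hc : Continuous (curl (W t)) := by
        have e : curl (W t) = fun x => curlCLM (fderiv ℝ (W t) x) :=
          funext fun x => curl_eq_curlCLM _ _
        rw [e]
        exact curlCLM.continuous.comp ((hW.contDiff_slice ht).continuous_fderiv (by simp))
      exact integrable_inner_of_continuous_of_hasCompactSupport hc hcψ hψcs
    -- the pairing of the difference is integrable, dominated by `Kψ ‖curl W t − ω₀‖`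
    have hintd : Integrable (fun x => ⟪curl (W t) x - curlCLM (Du₀ x), ψ x⟫)
        (volume : Measure (EuclideanSpace ℝ (Fin 3))) := by
      refine ((hdiff_int t ht).norm.mul_const Kψ).mono'
        ((hdiff_int t ht).1.inner hcψ.aestronglyMeasurable) (Eventually.of_forall fun x => ?_)
      rw [Real.norm_eq_abs]
      exact (abs_real_inner_le_norm _ _).trans (mul_le_mul_of_nonneg_left (hKψ x) (norm_nonneg _))
    have hint2 : Integrable (fun x => ⟪curlCLM (Du₀ x), ψ x⟫) (volume : Measure (EuclideanSpace ℝ (Fin 3))) := by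
      have e : (fun x => ⟪curlCLM (Du₀ x), ψ x⟫) =
          fun x => ⟪curl (W t) x, ψ x⟫ - ⟪curl (W t) x - curlCLM (Du₀ x), ψ x⟫ := by
        funext x; rw [inner_sub_left]; ring
      rw [e]; exact hint1.sub hintd
    have e2 : (∫ x, ⟪curl (W t) x, ψ x⟫) - ∫ x, ⟪curlCLM (Du₀ x), ψ x⟫ =
        ∫ x, ⟪curl (W t) x - curlCLM (Du₀ x), ψ x⟫ := by
      rw [← integral_sub hint1 hint2]
      refine integral_congr_ae (ae_of_all _ fun x => ?_)
      simp only [inner_sub_left]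
    rw [e2]
    calc ‖∫ x, ⟪curl (W t) x - curlCLM (Du₀ x), ψ x⟫‖
        ≤ ∫ x, ‖curl (W t) x - curlCLM (Du₀ x)‖ * Kψ := by
          refine norm_integral_le_of_norm_le ((hdiff_int t ht).norm.mul_const Kψ)
            (Eventually.of_forall fun x => ?_)
          rw [Real.norm_eq_abs]
          exact (abs_real_inner_le_norm _ _).trans (mul_le_mul_of_nonneg_left (hKψ x) (norm_nonneg _))
      _ = (∫ x, ‖curl (W t) x - curlCLM (Du₀ x)‖) * Kψ := integral_mul_const _ _
      _ ≤ 4 * (3 * V * L₁ * Real.sqrt (-t)) * Kψ := by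
          refine mul_le_mul_of_nonneg_right ?_ hK0
          rw [integral_norm_eq_lintegral_enorm (hdiff_int t ht).1]
          refine ENNReal.toReal_le_of_le_ofReal ?_ (lintegral_curl_sub_finalDatum_le hgradW hgenv hgrate ht)
          have hL₁ : 0 ≤ L₁ := by
            have h := (norm_nonneg _).trans (hgradW t ht 0)
            rw [norm_zero, zero_add] at h
            exact (div_nonneg_iff.1 h).elim (fun h' => h'.1)
              fun h' => absurd h'.2 (not_le.2 (pow_pos (Real.sqrt_pos.2 (neg_pos.2 ht)) 2))
          have : 0 ≤ V := by rw [hV]; positivity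
          positivity
      _ = Kψ * (4 * (3 * V * L₁ * Real.sqrt (-t))) := by ring
  -- ### Step 4: the majorant tends to `0`
  have hmaj : Tendsto (fun t : ℝ => Kψ * (4 * (3 * V * L₁ * Real.sqrt (-t)))) (𝓝[<] 0) (𝓝 0) := by
    have hc : Continuous fun t : ℝ => Kψ * (4 * (3 * V * L₁ * Real.sqrt (-t))) := by fun_prop
    have h0 : Kψ * (4 * (3 * V * L₁ * Real.sqrt (-(0 : ℝ)))) = 0 := by simp
    have h := hc.tendsto (0 : ℝ)
    rw [h0] at h
    exact h.mono_left nhdsWithin_le_nhds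
  rw [tendsto_iff_norm_sub_tendsto_zero]
  refine squeeze_zero' (Eventually.of_forall fun t => norm_nonneg _) ?_ hmaj
  filter_upwards [self_mem_nhdsWithin] with t ht
  exact hest t ht

end Summit.NavierStokesRegularity.NavierStokesRegularity.Theorems.FiniteDissipationLiouville.FinalDatumVorticity

end
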